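import Summits.ResolutionOfSingularities.ResolutionOfSingularities.Theorems.HilbertSamuelEliminationCampaignW42NormalConeRidgePoint
import Summits.ResolutionOfSingularities.ResolutionOfSingularities.Theorems.HilbertSamuelEliminationCampaignW42RidgeDimMonotoneOfThm3104
import Literature.RingTheory.HilbertSamuel.FlatRegularFibreHilbert
import Literature.RingTheory.HilbertSamuel.NormalFlatnessHilbertFunction
import Literature.RingTheory.HilbertSamuel.HilbertFunctionBaseChange
import Literature.RingTheory.HilbertSamuel.TangentConeChangeOfGenerators
import Literature.RingTheory.MvPolynomial.HilbertFunctionPolynomialExtensionAppend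
import Literature.AlgebraicGeometry.Resolution.HilbertSamuelValues
import HarnessLib

/-!
# [OURS · L1 W4.2] The tangent cone of a FLAT local extension with REGULAR fibre is the base-changed tangent cone times an
# affine space: `gr(B) = (gr(A) ⊗_{k_A} k_B)[T_1, …, T_d]`, hence `e(B)_K = e(A)_K + d`, `dim F(B) = dim F(A) + d`,
# `ē(B) = ē(A) + d` (Dietel (8.2.2) / CJS Lemma 2.27 (3); campaign s42, cell res-hironaka; informal crux `RidgeConfinement`,
# stmt-ResolutionOfSingularities-17845; `--supports`; brick B3 of the unconditional `RidgeDimMonotone`)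

HONEST FRAMING. OURS (slot W4.2, prover res-L1-s42-pv-1, gen 5). Let `(A, 𝔪_A, k_A) → (B, 𝔪_B, k_B)` be a flat local homomorphism
of noetherian local rings whose closed fibre `B̄ = B/𝔪_A B` is a regular local ring of dimension `d` (Dietel's Prop. (8.2.2), cf.
[Gi, II 3.4]: then `C_{B} ≅ C_A ×_{k_A} 𝔸^d_{k_B}`; CJS Lemma 2.27 (3)). The tree proves the NUMERICAL shadow `H⁽⁰⁾(B) = H⁽ᵈ⁾(A)`
(`hilbertFun_eq_hilbertSamuelFun_of_flat_of_isRegularLocalRing_fiber`, `FlatRegularFibreHilbert.lean`) and the case `d = 0`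
for the tangent cone ideal (`tangentConeIdeal_eq_map`, `TangentConeBaseChange.lean`). This file proves the GRADED statement for
every `d`, by the Hironaka–Grothendieck pattern of `HironakaGrothendieckIsomorphism.lean` (inclusion of homogeneous ideals plus
equality of Hilbert functions):

* `tangentConeIdeal_eq_map_of_flat_of_isRegularLocalRing_fiber` — for generators `x` of `𝔪_A` and `y` in `B` lifting a regular
  system of parameters of `B̄` (`𝔪_B = 𝔪_A B + (y)`), the tangent cone ideal of `B` in the generators `z = (x, y)` is the
  EXTENSION `J_x · k_B[X, Y]` of the tangent cone ideal `J_x ⊆ k_A[X]` of `A` (no relation involves the `Y`);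
* `spanFinrank_eq_add_of_flat_of_isRegularLocalRing_fiber` — `emb.dim B = emb.dim A + d`;
* **`dirDimOver_eq_add_of_flat_of_isRegularLocalRing_fiber`** — `e(B)_K = e(A)_K + d` for every field `K` over both residue
  fields compatibly (CJS Rem. 2.9 (c): `e(J·K[X,Y]) = e(J·K[X]) + d`, tree `directrixDim_map_rename_castAdd`);
  **`localRidgeDim_eq_add_…`** (`dim F(B) = dim F(A) + d`, Giraud's ridge — Dietel's `R_{X,x} = R⁽ᵈ⁾_{Y,y}` in (8.2.2)),
  **`geomDirDim_eq_add_…`** (`ē(B) = ē(A) + d`).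

Used downstream (`…CampaignW42ConeRidgeDimPoint`) for the purely transcendental thickening of a point of a cone (Dietel (8.2.4)).
NOTHING here is a statement of H. Hironaka's manuscript [Hironaka2017]. AI review is weaker than expert review.
References (orientation only): B. Dietel, Dissertation Regensburg (2015), Prop. (8.2.2) p. 97–98, Lemma (8.2.4); V. Cossart,
U. Jannsen, S. Saito, LNM 2270 (2020), Lemma 2.27 (2)–(3), Rem. 2.9 (c); J. Giraud, *Étude locale des singularités* (1972) II 3.4.
-/

noncomputable section

-- single-conjunct summit: the doubled namespace component `ResolutionOfSingularities` is mandated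
set_option linter.dupNamespace false

open IsLocalRing MvPolynomial Finset Module
open Literature.RingTheory.HilbertSamuel Literature.RingTheory.MvPolynomial
open Literature.AlgebraicGeometry.Resolution

namespace Summit.ResolutionOfSingularities.ResolutionOfSingularities.Theorems

namespace CampaignW42

universe u w

variable {A : Type u} {B : Type u} [CommRing A] [CommRing B] [IsLocalRing A] [IsLocalRing B] [IsNoetherianRing A]
  [IsNoetherianRing B] [Algebra A B] [Module.Flat A B] [IsLocalHom (algebraMap A B)]
  [IsRegularLocalRing (B ⧸ (maximalIdeal A).map (algebraMap A B))] {d : ℕ}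
  (hd : ringKrullDim (B ⧸ (maximalIdeal A).map (algebraMap A B)) = d)

/-! ## Generators `z = (x, y)` of `𝔪_B` -/

section Generators

variable {e : ℕ} {x : Fin e → A} (hx : Ideal.span (Set.range x) = maximalIdeal A) {y : Fin d → B}
  (hy : maximalIdeal B = (maximalIdeal A).map (algebraMap A B) ⊔ Ideal.span (Set.range y))

omit [IsLocalRing A] [IsLocalRing B] [IsNoetherianRing A] [IsNoetherianRing B] [Module.Flat A B]
  [IsLocalHom (algebraMap A B)] [IsRegularLocalRing (B ⧸ (maximalIdeal A).map (algebraMap A B))] in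
/-- The range of the concatenated family `(f ∘ x, y)`. [folklore] -/
theorem range_append_comp (x : Fin e → A) (y : Fin d → B) :
    Set.range (Fin.append ((algebraMap A B) ∘ x) y) = (algebraMap A B) '' Set.range x ∪ Set.range y := by
  ext b
  simp only [Set.mem_range, Set.mem_union, Set.mem_image, exists_exists_eq_and]
  constructor
  · rintro ⟨j, rfl⟩
    refine Fin.addCases (fun l => ?_) (fun l => ?_) j
    · exact Or.inl ⟨l, by rw [Fin.append_left, Function.comp_apply]⟩
    · exact Or.inr ⟨l, by rw [Fin.append_right]⟩
  · rintro (⟨l, rfl⟩ | ⟨l, rfl⟩)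
    · exact ⟨Fin.castAdd d l, by rw [Fin.append_left, Function.comp_apply]⟩
    · exact ⟨Fin.natAdd e l, by rw [Fin.append_right]⟩

omit [IsNoetherianRing A] [IsNoetherianRing B] [Module.Flat A B] [IsLocalHom (algebraMap A B)]
  [IsRegularLocalRing (B ⧸ (maximalIdeal A).map (algebraMap A B))] in
include hx hy in
/-- **`z = (f(x), y)` generates `𝔪_B`** when `x` generates `𝔪_A` and `𝔪_B = 𝔪_A B + (y)`. [cite: Dietel2015, Prop. (8.2.2)] -/
theorem span_range_append_eq_maximalIdeal :
    Ideal.span (Set.range (Fin.append ((algebraMap A B) ∘ x) y)) = maximalIdeal B := by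
  rw [range_append_comp, Ideal.span_union, ← Ideal.map_span, hx, ← hy]

end Generators

/-! ## The tangent cone ideal of `B` is the extension of that of `A` -/

section TangentCone

variable {e : ℕ} {x : Fin e → A} (hx : Ideal.span (Set.range x) = maximalIdeal A) {y : Fin d → B}
  (hy : maximalIdeal B = (maximalIdeal A).map (algebraMap A B) ⊔ Ideal.span (Set.range y))

include hd in
/-- **`gr(B) = (gr(A) ⊗ k_B)[Y]` for a flat local map with regular fibre of dimension `d`**: in the generators `z = (f(x), y)`
of `𝔪_B`, the tangent cone ideal of `B` is `(J_x · k_B[X]) · k_B[X, Y]` — the extension of the tangent cone ideal of `A` in the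
generators `x`, along the residue field map and the inclusion of variables `X_i ↦ Z_i` (`i ≤ e`). Proof: `⊇` relations map to
relations; both ideals are homogeneous with the same Hilbert function (`H(k_B[X,Y]/J_x k_B[X,Y]) = H⁽ᵈ⁾(k_A[X]/J_x) = H⁽ᵈ⁾(A) =
H⁽⁰⁾(B)`, the last step being the tree's `hilbertFun_eq_hilbertSamuelFun_of_flat_of_isRegularLocalRing_fiber`).
[cite: Dietel2015, Prop. (8.2.2) p. 97–98] [cite: CossartJannsenSaito2020, Lemma 2.27 (2)–(3)] -/
theorem tangentConeIdeal_eq_map_of_flat_of_isRegularLocalRing_fiber :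
    tangentConeIdeal (Fin.append ((algebraMap A B) ∘ x) y) (span_range_append_eq_maximalIdeal hx hy) =
      ((tangentConeIdeal x hx).map (MvPolynomial.map (ResidueField.map (algebraMap A B)))).map
        ((rename (Fin.castAdd d) : MvPolynomial (Fin e) (ResidueField B) →ₐ[ResidueField B]
            MvPolynomial (Fin (e + d)) (ResidueField B)) :
          MvPolynomial (Fin e) (ResidueField B) →+* MvPolynomial (Fin (e + d)) (ResidueField B)) := by
  classical
  have hz := span_range_append_eq_maximalIdeal hx hy
  set kB := ResidueField B
  set κ : ResidueField A →+* kB := ResidueField.map (algebraMap A B) with hκ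
  set ρ : MvPolynomial (Fin e) kB →+* MvPolynomial (Fin (e + d)) kB :=
    ((rename (Fin.castAdd d) : MvPolynomial (Fin e) kB →ₐ[kB] MvPolynomial (Fin (e + d)) kB) :
      MvPolynomial (Fin e) kB →+* MvPolynomial (Fin (e + d)) kB) with hρ
  set Jz := tangentConeIdeal (Fin.append ((algebraMap A B) ∘ x) y) hz with hJz
  set J' := ((tangentConeIdeal x hx).map (MvPolynomial.map κ)).map ρ with hJ'
  have hmB : (maximalIdeal A).map (algebraMap A B) ≤ maximalIdeal B := by rw [hy]; exact le_sup_left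
  -- (1) the trivial half: relations of `A` map to relations of `B`
  have hle : J' ≤ Jz := by
    rw [hJ', Ideal.map_map, Ideal.map_le_iff_le_comap, tangentConeIdeal, Ideal.span_le]
    intro g hg
    obtain ⟨n, hgn⟩ := Set.mem_iUnion.mp hg
    obtain ⟨F, hFhom, hFx, rfl⟩ := (mem_symbolForms_iff_exists_form x hx).mp hgn
    rw [SetLike.mem_coe, Ideal.mem_comap, RingHom.comp_apply]
    have hcalc : ρ (MvPolynomial.map κ (MvPolynomial.map (residue A) F)) =
        MvPolynomial.map (residue B) (rename (Fin.castAdd d) (MvPolynomial.map (algebraMap A B) F)) := by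
      rw [hρ, MvPolynomial.map_map, hκ, ResidueField.map_comp_residue, ← MvPolynomial.map_map, AlgHom.coe_toRingHom,
        map_rename]
    rw [hcalc]
    refine mem_tangentConeIdeal_of_mem_symbolForms _ hz n ((mem_symbolForms_iff_exists_form _ hz).mpr
      ⟨_, (hFhom.map (algebraMap A B)).rename_isHomogeneous, ?_, rfl⟩)
    rw [eval_rename]
    have hcomp : (Fin.append ((algebraMap A B) ∘ x) y) ∘ Fin.castAdd d = (algebraMap A B) ∘ x := by
      funext i; exact Fin.append_left _ y i
    rw [hcomp, ← map_eval]
    exact Ideal.pow_right_mono hmB _ (by rw [← Ideal.map_pow]; exact Ideal.mem_map_of_mem _ hFx)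
  -- (2) equality of Hilbert functions
  have hH : ∀ n, hilbertFunQuot kB (e + d) J' n = hilbertFunQuot kB (e + d) Jz n := fun n => by
    rw [hJz, hilbertFunQuot_tangentConeIdeal _ hz, hJ', hρ, hilbertFunQuot_map_rename_castAdd,
      hilbertFunQuot_map κ (isHomogeneousIdeal_tangentConeIdeal x hx), hilbertFunQuot_tangentConeIdeal x hx,
      hilbertFun_eq_hilbertSamuelFun_of_flat_of_isRegularLocalRing_fiber hd]
    rfl
  -- (3) degreewise equality of the homogeneous parts
  haveI hfin : ∀ n, Module.Finite kB (homogeneousSubmodule (Fin (e + d)) kB n) := fun n =>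
    Module.Finite.iff_fg.mpr (homogeneousSubmodule_fg (Fin (e + d)) kB n)
  have hJzhom : IsHomogeneousIdeal Jz := isHomogeneousIdeal_tangentConeIdeal _ hz
  have hdeg : ∀ n, idealDegree J' n = idealDegree Jz n := fun n => by
    have hsub : idealDegree J' n ≤ idealDegree Jz n := fun f hf =>
      mem_idealDegree.mpr ⟨hle (mem_idealDegree.mp hf).1, (mem_idealDegree.mp hf).2⟩
    have hJzle : idealDegree Jz n ≤ homogeneousSubmodule (Fin (e + d)) kB n := inf_le_right
    have hJ'le : idealDegree J' n ≤ homogeneousSubmodule (Fin (e + d)) kB n := inf_le_right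
    haveI : Module.Finite kB (idealDegree Jz n) :=
      Module.Finite.of_injective (Submodule.inclusion hJzle) (Submodule.inclusion_injective hJzle)
    refine Submodule.eq_of_le_of_finrank_le hsub ?_
    have h1 := hH n
    unfold hilbertFunQuot at h1
    have h2 : finrank kB (idealDegree Jz n) ≤ finrank kB (homogeneousSubmodule (Fin (e + d)) kB n) :=
      Submodule.finrank_mono hJzle
    have h3 : finrank kB (idealDegree J' n) ≤ finrank kB (homogeneousSubmodule (Fin (e + d)) kB n) :=
      Submodule.finrank_mono hJ'le
    change finrank kB (homogeneousSubmodule (Fin (e + d)) kB n) - finrank kB (idealDegree J' n) =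
      finrank kB (homogeneousSubmodule (Fin (e + d)) kB n) - finrank kB (idealDegree Jz n) at h1
    have h4 : finrank kB (idealDegree Jz n) = finrank kB (idealDegree J' n) := by omega
    exact h4.le
  -- (4) conclude
  refine le_antisymm (fun f hf => ?_) hle
  rw [← sum_homogeneousComponent f]
  refine Ideal.sum_mem _ fun n _ => ?_
  have hc : homogeneousComponent n f ∈ idealDegree Jz n :=
    mem_idealDegree.mpr ⟨hJzhom f hf n, homogeneousComponent_isHomogeneous n f⟩
  rw [← hdeg n] at hc
  exact (mem_idealDegree.mp hc).1

end TangentCone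

/-! ## Numerical consequences: `emb.dim`, `e_K`, `dim F`, `ē` all go up by exactly `d` -/

omit [IsLocalHom (algebraMap A B)] in
include hd in
/-- **`emb.dim B = emb.dim A + d`** (`H⁽⁰⁾(B)(1) = H⁽ᵈ⁾(A)(1) = d + emb.dim A`). [cite: Dietel2015, Prop. (8.2.2)] -/
theorem spanFinrank_eq_add_of_flat_of_isRegularLocalRing_fiber :
    (maximalIdeal B).spanFinrank = (maximalIdeal A).spanFinrank + d := by
  have h := congr_fun (hilbertFun_eq_hilbertSamuelFun_of_flat_of_isRegularLocalRing_fiber (A := A) (B := B) hd) 1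
  rw [hilbertFun_one_eq_spanFinrank, Literature.RingTheory.HilbertSamuel.hilbertSamuelFun_apply_one] at h
  omega

include hd in
/-- **`e(B)_K = e(A)_K + d` for a flat local map with regular fibre of dimension `d`**, for every field `K` over both residue
fields compatibly (`k_A → k_B → K`): the directrix of `(J_x · K[X]) · K[X, Y]` has `d` more dimensions than that of `J_x · K[X]`
(CJS Rem. 2.9 (c)). Dietel (8.2.2): `C_B ≅ C_A ×_{k_A} 𝔸^d_{k_B}`; CJS Lemma 2.27 (3): `e_{x'}(X') = e_x(X) + d`.
[cite: Dietel2015, Prop. (8.2.2) p. 97] [cite: CossartJannsenSaito2020, Lemma 2.27 (3), Rem. 2.9 (c)] -/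
theorem dirDimOver_eq_add_of_flat_of_isRegularLocalRing_fiber (K : Type w) [Field K] [Algebra (ResidueField A) K]
    [Algebra (ResidueField B) K]
    (hKc : (algebraMap (ResidueField B) K).comp (ResidueField.map (algebraMap A B)) = algebraMap (ResidueField A) K) :
    dirDimOver B K = dirDimOver A K + d := by
  classical
  haveI : IsDomain (B ⧸ (maximalIdeal A).map (algebraMap A B)) := isDomain_of_isRegularLocalRing _
  haveI : ((maximalIdeal A).map (algebraMap A B)).IsPrime := (Ideal.Quotient.isDomain_iff_prime _).mp inferInstance
  obtain ⟨y, hy⟩ := exists_maximalIdeal_eq_sup_span_range (𝔭 := (maximalIdeal A).map (algebraMap A B)) hd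
  have hx := span_range_minGenerators A
  have hz := span_range_append_eq_maximalIdeal hx hy
  have he : (maximalIdeal B).spanFinrank = (maximalIdeal A).spanFinrank + d :=
    spanFinrank_eq_add_of_flat_of_isRegularLocalRing_fiber hd
  rw [dirDimOver_eq' B K he _ hz]
  unfold dirDimOver canonicalTangentConeIdeal
  rw [tangentConeIdeal_eq_map_of_flat_of_isRegularLocalRing_fiber hd hx hy, Ideal.map_map, Ideal.map_map]
  set e := (maximalIdeal A).spanFinrank
  -- `map ι_B ∘ rename ∘ map κ = rename ∘ map ι_A`
  have hcomp : ((MvPolynomial.map (algebraMap (ResidueField B) K)).comp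
      ((rename (Fin.castAdd d) : MvPolynomial (Fin e) (ResidueField B) →ₐ[ResidueField B]
          MvPolynomial (Fin (e + d)) (ResidueField B)) :
          MvPolynomial (Fin e) (ResidueField B) →+* MvPolynomial (Fin (e + d)) (ResidueField B))).comp
        (MvPolynomial.map (ResidueField.map (algebraMap A B))) =
      ((rename (Fin.castAdd d) : MvPolynomial (Fin e) K →ₐ[K] MvPolynomial (Fin (e + d)) K) :
          MvPolynomial (Fin e) K →+* MvPolynomial (Fin (e + d)) K).comp
        (MvPolynomial.map (algebraMap (ResidueField A) K)) := by
    refine RingHom.ext fun p => ?_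
    simp only [RingHom.comp_apply, AlgHom.coe_toRingHom, map_rename, MvPolynomial.map_map, hKc]
  rw [hcomp, ← Ideal.map_map, directrixDim_map_rename_castAdd]

include hd in
/-- **`dim F(B) = dim F(A) + d`** (Giraud's ridge) for a flat local map with regular fibre of dimension `d` — Dietel's
`R_{X,x} = R⁽ᵈ⁾_{Y,y}` in (8.2.2) (`dim F = e_K` at the perfect field `K = k_B^{alg}`).
[cite: Dietel2015, Prop. (8.2.2) p. 97; (8.1.3) (iii)] -/
theorem localRidgeDim_eq_add_of_flat_of_isRegularLocalRing_fiber : localRidgeDim B = localRidgeDim A + d := by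
  let K := AlgebraicClosure (ResidueField B)
  letI : Algebra (ResidueField A) K := ((algebraMap (ResidueField B) K).comp (ResidueField.map (algebraMap A B))).toAlgebra
  rw [localRidgeDim_eq_dirDimOver_of_perfectField A K, localRidgeDim_eq_dirDimOver_of_perfectField B K]
  exact dirDimOver_eq_add_of_flat_of_isRegularLocalRing_fiber hd K rfl

include hd in
/-- **`ē(B) = ē(A) + d`** for a flat local map with regular fibre of dimension `d`. [cite: CossartJannsenSaito2020, Lemma 2.27 (3)] -/
theorem geomDirDim_eq_add_of_flat_of_isRegularLocalRing_fiber : geomDirDim B = geomDirDim A + d := by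
  have hA : geomDirDim A = localRidgeDim A := (localRidgeDim_eq_dirDimOver_of_perfectField A _).symm
  have hB : geomDirDim B = localRidgeDim B := (localRidgeDim_eq_dirDimOver_of_perfectField B _).symm
  rw [hA, hB]
  exact localRidgeDim_eq_add_of_flat_of_isRegularLocalRing_fiber hd

end CampaignW42

end Summit.ResolutionOfSingularities.ResolutionOfSingularities.Theorems

end
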